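import Mathlib
import Summits.CriticalPhenomena.SAWScalingLimit.Theorems.SAWDefectDecoherenceDefectDecoherenceSsSectorRows
import Summits.CriticalPhenomena.SAWScalingLimit.Theorems.SAWDefectDecoherenceDefectDecoherenceSsDressingPairsAux
import HarnessLib

/-!
# The discrete Poisson equation of the unstable sector (line `sector-slaving`, crux `DefectDecoherence`,
stmt-CriticalPhenomena-8549; lead prover c2)

Two landed exact identities are combined: the `U`-row of the nearest-neighbour sector system
(`ss_sectorRowU`, a pure one-step bookkeeping identity valid in every domain at a `2`-deep vertex) expresses
the FULL via-dart sum `Ā_U(v) = Ā_{-3/8}(v)` through the clean sectors at the three neighbours, and the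
vertex relation of Duminil-Copin–Smirnov in sector form (`ss_unstableNoDressing`: `Ā_U = A_U`, the DCS pair
cancellation, which needs the simply connected domain and the boundary root) removes the loop dressing on the
left.  The result (`ss_unstable_poisson`) is the **discrete Poisson equation of the unstable sector**:

`A_U(v) = (1/3) Σ_{t ∼ v} A_U(t) + (c_S/3) Σ_{t ∼ v} e(t) A_S(t) + (c_D/3) Σ_{t ∼ v} e(t)² A_D(t)`,
`c_S = 2x_c cos(5π/24)`, `c_D = 2x_c cos(13π/24)`, `e(t) = dartUnit v t`,

i.e. the `U`-sector of the `x_c`-weighted clean arrival law is discrete-HARMONIC on the honeycomb lattice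
(mean-value property over the star) modulo two first-order sources: the Cauchy–Riemann combination
`Σ_t e(t) S(t)` of the signal sector and the `∂`-combination `Σ_t e(t)² D(t)` of the defect sector
(`ss_unstable_meanValue_defect`).  This is where the vertex relation enters the sector picture (the
`U`-coupling `2x_c cos(π/8) = 1`); it is the starting point of the "engine (b)" reading of the hardest stub
`stub_unstableStarGradient` (the crux's leading term is `ℓ·∂̄U/3`: an interior gradient estimate for an
almost-harmonic lattice field, which would follow from a polynomially-lossy Harnack comparability of the
critical masses over the deep ball plus second-order discrete holomorphy of `S` — both open).

Sources: H. Duminil-Copin, S. Smirnov, Ann. of Math. 175 (2012) (arXiv:1007.0575), Lemma 1; the line card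
`Cruxes/DefectDecoherence/Lines/sector-slaving.md` (engine (b), `SectorSystem`, `UnstableNoDressing`).
-/

noncomputable section

open scoped BigOperators ComplexConjugate Classical
open Literature.Probability.LatticeModels Literature.Probability.RandomPlanarGeometry.SAW
open Summit.CriticalPhenomena.SAWScalingLimit.Theorems.DefectDecoherence.TipMartingale

namespace Summit.CriticalPhenomena.SAWScalingLimit.Theorems.DefectDecoherence.SectorSlaving

/-- **Discrete Poisson equation of the unstable sector.**  In a simply connected `Λ` with adjacent
boundary root `s(u,w)` (`u ∉ Λ ∋ w`), at every `2`-deep vertex `v`: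
`A_U(v) = Σ_{t ∈ star Λ v} [(1/3) A_U(t) + (2x_c cos(5π/24)/3)·e(t)·A_S(t) + (2x_c cos(13π/24)/3)·e(t)²·A_D(t)]`
(`U`-row of the sector system + `Ā_U = A_U`). [cite: DuminilCopinSmirnov2012, Lemma 1] -/
theorem ss_unstable_poisson : ∀ (Λ : Finset HexVertex), hexDomainSimplyConnected Λ →
    ∀ (u w : HexVertex), hexGraph.Adj u w → u ∉ Λ → w ∈ Λ →
      ∀ v : HexVertex, Deep Λ v 2 →
        arrivalSum Λ s(u, w) (rootAngle u w) (-3 / 8) v =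
          ∑ t ∈ star Λ v,
            ((1 / 3 : ℂ) * arrivalSum Λ s(u, w) (rootAngle u w) (-3 / 8) t +
                ((2 * xc * Real.cos (5 * Real.pi / 24) / 3 : ℝ) : ℂ) * dartUnit v t *
                  arrivalSum Λ s(u, w) (rootAngle u w) (5 / 8) t +
              ((2 * xc * Real.cos (13 * Real.pi / 24) / 3 : ℝ) : ℂ) * dartUnit v t ^ 2 *
                arrivalSum Λ s(u, w) (rootAngle u w) (13 / 8) t) := by
  intro Λ hΛ u w huw hu hw v hdeep
  have hdeep1 : Deep Λ v 1 := fun y hy => hdeep y (hy.trans (by norm_num))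
  rw [← ss_unstableNoDressing Λ hΛ u w huw hu hw v hdeep1]
  exact ss_sectorRowU Λ u w huw hu hw v hdeep

/-- **Mean-value defect of the unstable sector = the two first-order sources.**  Same setting:
`A_U(v) − (1/3) Σ_{t ∼ v} A_U(t) = (2x_c cos(5π/24)/3)·Σ_t e(t) A_S(t) + (2x_c cos(13π/24)/3)·Σ_t e(t)² A_D(t)`
— the discrete Laplacian of `U` at `v` is the Cauchy–Riemann combination of the signal sector plus the
`∂`-combination of the defect sector. [cite: DuminilCopinSmirnov2012, Lemma 1] -/
theorem ss_unstable_meanValue_defect : ∀ (Λ : Finset HexVertex), hexDomainSimplyConnected Λ →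
    ∀ (u w : HexVertex), hexGraph.Adj u w → u ∉ Λ → w ∈ Λ →
      ∀ v : HexVertex, Deep Λ v 2 →
        arrivalSum Λ s(u, w) (rootAngle u w) (-3 / 8) v -
            (1 / 3 : ℂ) * ∑ t ∈ star Λ v, arrivalSum Λ s(u, w) (rootAngle u w) (-3 / 8) t =
          ((2 * xc * Real.cos (5 * Real.pi / 24) / 3 : ℝ) : ℂ) *
              ∑ t ∈ star Λ v, dartUnit v t * arrivalSum Λ s(u, w) (rootAngle u w) (5 / 8) t +
            ((2 * xc * Real.cos (13 * Real.pi / 24) / 3 : ℝ) : ℂ) *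
              ∑ t ∈ star Λ v, dartUnit v t ^ 2 * arrivalSum Λ s(u, w) (rootAngle u w) (13 / 8) t := by
  intro Λ hΛ u w huw hu hw v hdeep
  rw [ss_unstable_poisson Λ hΛ u w huw hu hw v hdeep, Finset.mul_sum, Finset.mul_sum, Finset.mul_sum,
    ← Finset.sum_sub_distrib, ← Finset.sum_add_distrib]
  refine Finset.sum_congr rfl fun t _ => ?_
  ring

end Summit.CriticalPhenomena.SAWScalingLimit.Theorems.DefectDecoherence.SectorSlaving

end
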